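import Literature.Computability.AlgebraicComplexity.DIP20Prop51Certificates47U29A
import HarnessLib

set_option Elab.async false
set_option maxRecDepth 100000

/-!
# Dörfler–Ikenmeyer–Panova 2020, Prop. 5.1, the `Ch_4^7` half — kernel certificate for the row `(16, 11, 11, 4)`, PART B (DIP20Prop51Certificates47U29B)

Topic `Literature/Computability/AlgebraicComplexity`; certificate file (cell `val-lit`, unit val-lit-t06 g4, generated with
val-lit-t07 g4's `gen47.py` from the certificate record `certs/cert47-all.json (05:22Z merge; t05 g6 wave certB02)` (column-symmetrised record, engine `S`)
and SPLIT at theorem boundaries so that no part exceeds the gate's elaboration budget (lead-bip #23: ≤ 80 k transitions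
per file): part A (`DIP20Prop51Certificates47U29A`) = the data `def`s (network, integer Chow point, content table and its check, ALL literal intermediate layers) + kernel chunk 1; part B (`DIP20Prop51Certificates47U29B`) = kernel chunk 2; part C (`DIP20Prop51Certificates47U29C`) = kernel chunk 3 + the recombined value + the closer.
THIS is part B: `chow47Layer_16_11_11_4_3_eq`. Theorem-only (no `def`, no fact, no notion); D-0014 sibling of
`DIP20MultiplicityObstructions.lean`, named fact `DIP20_prop_5_1`, SECOND conjunct
`∀ μ ∈ dipGenerators47, 0 < coordRingMultiplicity ℂ (chowSet ℂ 4 7) 7 (rowDual μ)`.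

J. Dörfler, C. Ikenmeyer, G. Panova, *On geometric complexity theory: multiplicity obstructions are stronger than
occurrence obstructions*, SIAM J. Appl. Algebra Geom. 4 (2020) = arXiv:1901.04576, Prop. 5.1 (arXiv p. 12; "Proposition 18"
of the e-print): "If `X` is defined as in Proposition 7.1, then for all `μ ∈ X` we have `mult_μ(ℂ[Ch_4^7]) > 0`" — here the row
`μ = (16, 11, 11, 4)` of `X`; see part A for the full account of the replayed verification (§5, pp. 12–13: one highest-weight
vector of a column-strict filling evaluated at one integer point of `Ch_4^7`; §8, pp. 17–19).

HONEST FRAMING: replay of a published computer verification in the toy model `Ch_4^7` (Chow variety versus power sums);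
nothing here bears on permanent versus determinant; VP ≠ VNP is not proved.

## References

* J. Dörfler, C. Ikenmeyer, G. Panova, SIAM J. Appl. Algebra Geom. 4 (2020) = arXiv:1901.04576, Prop. 5.1 and §5
  (arXiv pp. 12–13), Prop. 7.1 (the set `X`, p. 16), §8 (the tableaux, pp. 17–19). [DorflerIkenmeyerPanova2020]

## Mathlib and tree

Tree: the earlier parts of this certificate (data `def`s `chow47Net_16_11_11_4`, `chow47Rows_16_11_11_4`, `chow47Tab_16_11_11_4`, the literal layers
`chow47Layer_16_11_11_4_*`, and their kernel theorems); `evalTS`, `layersS`, `layerSum`, `tableTrie`, `evalTS_eq_layerSum_split`,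
`layersS_append`, `coordRingMultiplicity_chowSet_pos_of_tableCertificateS` (`TableauEvalLabelMajorSymm`, val-lit-t07 g4);
`partitionOfList`, `sortedParts_partitionOfList` (`DIP20HookLikeTails`); `rowDual`, `rowDual_sortedParts`, `chowSet`,
`coordRingMultiplicity` (`DIP20MultiplicityObstructions`). Mathlib: `decide +kernel`.
-/

namespace Literature.Computability.AlgebraicComplexity

namespace TableauEval

/-- Kernel chunk 2: the labels `2, …, 2` lead from `chow47Layer_16_11_11_4_2` to `chow47Layer_16_11_11_4_3` (40879 transitions on the desk). [cite: DorflerIkenmeyerPanova2020, Prop. 5.1 and §5, §8 (arXiv pp. 12–13, 17–19)] -/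
theorem chow47Layer_16_11_11_4_3_eq :
    layersS chow47Net_16_11_11_4.cols chow47Net_16_11_11_4.varBound (tableTrie chow47Net_16_11_11_4.varBound chow47Tab_16_11_11_4 chow47Net_16_11_11_4.perLabel [])
      (List.range' 2 1) chow47Layer_16_11_11_4_2 = chow47Layer_16_11_11_4_3 := by
  decide +kernel

end TableauEval

end Literature.Computability.AlgebraicComplexity
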